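import Mathlib
import Summits.Ventures.HodgeRepro.Tier4.Target
import Summits.Ventures.HodgeRepro.Tier4.Line3.Defs
import Summits.Ventures.HodgeRepro.Tier4.Line3.DefsLemmas
import Summits.Ventures.HodgeRepro.Tier4.Line3.GaussRatioFormula
import Summits.Ventures.HodgeRepro.Tier4.Line3.CopyRemainder
import Summits.Ventures.HodgeRepro.Tier4.Line3.CopyWeightGaussian
import Summits.Ventures.HodgeRepro.Tier4.Line3.CopyWeightBoundShrink
import Summits.Ventures.HodgeRepro.Tier4.Line3.CopyWeightBoundShrinkRed
import Summits.Ventures.HodgeRepro.Tier4.Line3.LatticeGaussSummable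
import Summits.Ventures.HodgeRepro.Tier4.Line3.CopyCountSummable
import Summits.Ventures.HodgeRepro.Tier4.Line3.ShrinkMajGauss
import Summits.Ventures.HodgeRepro.Tier4.Line3.GaussCountRay
import Summits.Ventures.HodgeRepro.Tier4.Line3.CopyCountShrink
import Summits.Ventures.HodgeRepro.Tier4.Line3.CopyCountRay
import Summits.Ventures.HodgeRepro.Tier4.Line3.CopyCountRayRed

/-!
# Tier4/Line3/CopyCountRayWeighted — the copy count along the ray with a POLYNOMIAL phase weight

Blind re-derivation cell `pub-hodge-repro`, Tier 4 «PROVE THE STEP», LINE L3, seat t4-x2 (g4, reserve wall-breaker),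
cut C-L3-WEIGHT (plan-3 g4, bus S14888) — the repair of the uniform phase bound `Λ₀` found MISSTATED on the natural data
(C-L3-LAMBDA, census §G V34–V36): the sphere-symmetry constants of a scalar copy grow like the split-divisor function of the
norms, so the honest bound is `‖Λ(o)‖ ≤ Λ₀ · scalarWeight e (rep o)` with the tree-native weight
`scalarWeight e ε := ∏_j (∏_σ (1 + ‖σ (ε j)‖²))^e`, `e ≥ 0` displayed.

The weight is ABSORBED by the Gaussian of the ray: `scalarWeight e ε ≤ e^{e Σ_j Σ_σ ‖σ(ε j)‖²}` (`1 + t ≤ e^t`), and under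
the QUADRATIC LOWER BOUND of the profile exponent on the window, `a₀ Σ_j Σ_σ ‖σ (ε j)‖² − b₀ ≤ profileExc ε xm`, the
weighted base term is `≤ shrinkW · Λ₀ e^{π b₀} · e^{−(π a₀ − e) Σ}` — a Gaussian in the houses once `e < π a₀`, the
shrink factor `(min 1 t²)^{−k}` absorbed as in ShrinkMajGauss.  Then the count along the ray is the unweighted Tannery
argument of CopyCountRayRed with the weight carried in `gaussCount`'s weights: `eventually_copyCount_rayCentre_red_weighted`
has the conclusion of `eventually_copyCount_rayCentre_red` VERBATIM (`e := 0`, `b₀ := 0` recovers it).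

Nothing here says anything about the status of the Hodge conjecture for CM abelian varieties, which is NOT proved
(HC_CM is NOT proved by anyone in this repository).
-/

set_option autoImplicit false

noncomputable section

namespace Summit.Ventures.HodgeRepro.Tier4.Line3

open Summit.Ventures.HodgeRepro.Tier4
open Matrix NumberField NumberField.mixedEmbedding Filter
open scoped ComplexConjugate
open scoped Classical

namespace T4Data

variable (X : T4Data)

/-! ## 1. The polynomial weight -/

/-- **THE POLYNOMIAL PHASE WEIGHT** `∏_j (∏_σ (1 + ‖σ (ε j)‖²))^e`. -/
def scalarWeight (e : ℝ) (ε : Fin 4 → X.E) : ℝ :=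
  ∏ j, (∏ σ : X.E →+* ℂ, (1 + ‖σ (ε j)‖ ^ 2)) ^ e

/-- The weight is non-negative. -/
theorem scalarWeight_nonneg (e : ℝ) (ε : Fin 4 → X.E) : 0 ≤ X.scalarWeight e ε :=
  Finset.prod_nonneg fun j _ => Real.rpow_nonneg (Finset.prod_nonneg fun σ _ => by positivity) _

/-- The weight is dominated by the Gaussian `e^{e Σ_j Σ_σ ‖σ (ε j)‖²}` (`1 + t ≤ e^t`). -/
theorem scalarWeight_le_exp {e : ℝ} (he : 0 ≤ e) (ε : Fin 4 → X.E) :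
    X.scalarWeight e ε ≤ Real.exp (e * ∑ j, ∑ σ : X.E →+* ℂ, ‖σ (ε j)‖ ^ 2) := by
  unfold scalarWeight
  rw [Finset.mul_sum, Real.exp_sum]
  refine Finset.prod_le_prod (fun j _ => Real.rpow_nonneg (Finset.prod_nonneg fun σ _ => by positivity) _)
    fun j _ => ?_
  have h1 : ∏ σ : X.E →+* ℂ, (1 + ‖σ (ε j)‖ ^ 2) ≤ Real.exp (∑ σ : X.E →+* ℂ, ‖σ (ε j)‖ ^ 2) := by
    rw [Real.exp_sum]
    refine Finset.prod_le_prod (fun σ _ => by positivity) fun σ _ => ?_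
    have := Real.add_one_le_exp (‖σ (ε j)‖ ^ 2)
    linarith
  calc (∏ σ : X.E →+* ℂ, (1 + ‖σ (ε j)‖ ^ 2)) ^ e ≤ (Real.exp (∑ σ : X.E →+* ℂ, ‖σ (ε j)‖ ^ 2)) ^ e :=
        Real.rpow_le_rpow (Finset.prod_nonneg fun σ _ => by positivity) h1 he
    _ = Real.exp (e * ∑ σ : X.E →+* ℂ, ‖σ (ε j)‖ ^ 2) := by rw [← Real.exp_mul, mul_comm]

/-! ## 2. The shrink factor is polynomial in the slot sizes -/

/-- The `τ₀`-size is one of the slot sizes. -/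
theorem tau_sq_le_sum (x : X.E) : ‖X.τ₀ x‖ ^ 2 ≤ ∑ σ : X.E →+* ℂ, ‖σ x‖ ^ 2 :=
  Finset.single_le_sum (fun σ _ => sq_nonneg (‖σ x‖)) (Finset.mem_univ X.τ₀)

/-- The definite sizes are at most the sum of all slot sizes. -/
theorem sum_def_le_sum (x : X.E) : ∑ σ ∈ X.defEmb, ‖σ x‖ ^ 2 ≤ ∑ σ : X.E →+* ℂ, ‖σ x‖ ^ 2 :=
  Finset.sum_le_sum_of_subset_of_nonneg (Finset.subset_univ _) (fun _ _ _ => sq_nonneg _)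

/-- The house is bounded by the sum of all slot sizes. -/
theorem mixed_norm_sq_le_sum (x : X.E) : ‖mixedEmbedding X.E x‖ ^ 2 ≤ ∑ σ : X.E →+* ℂ, ‖σ x‖ ^ 2 := by
  have h1 := X.mixed_norm_sq_le x
  have h2 : ‖X.τ₀ x‖ ^ 2 + ∑ σ ∈ X.defEmb, ‖σ x‖ ^ 2 ≤ ∑ σ : X.E →+* ℂ, ‖σ x‖ ^ 2 := by
    have hnot : X.τ₀ ∉ X.defEmb := by simp [defEmb]
    have hins : ∑ σ ∈ insert X.τ₀ X.defEmb, ‖σ x‖ ^ 2 = ‖X.τ₀ x‖ ^ 2 + ∑ σ ∈ X.defEmb, ‖σ x‖ ^ 2 :=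
      Finset.sum_insert hnot
    rw [← hins]
    exact Finset.sum_le_sum_of_subset_of_nonneg (Finset.subset_univ _) (fun _ _ _ => sq_nonneg _)
  linarith

/-- **THE SHRINK FACTOR IS POLYNOMIAL IN THE SLOT SIZES**: for a non-zero algebraic integer `x`,
`‖τ₀ x‖² (min 1 ‖τ₀ x‖²)^{−k} ≤ (1 + Σ_σ ‖σ x‖²)^{|defEmb| k + 1}`. -/
theorem slot_poly_le {x : X.E} (hx : IsIntegral ℤ x) (h0 : x ≠ 0) {k : ℝ} (hk : 0 ≤ k) :
    ‖X.τ₀ x‖ ^ 2 * (min 1 (‖X.τ₀ x‖ ^ 2)) ^ (-k) ≤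
      (1 + ∑ σ : X.E →+* ℂ, ‖σ x‖ ^ 2) ^ ((X.defEmb.card : ℝ) * k + 1) := by
  set P : ℝ := ∑ σ : X.E →+* ℂ, ‖σ x‖ ^ 2 with hP
  have hP0 : 0 ≤ P := Finset.sum_nonneg fun σ _ => sq_nonneg _
  have ht : 0 < ‖X.τ₀ x‖ := norm_pos_iff.2 ((map_ne_zero _).2 h0)
  have hsh := shrink_factor_le X.defEmb ht hk (fun σ => ‖σ x‖) (fun σ _ => norm_nonneg _)
    (X.one_le_tau_sq_mul_prod_def hx h0)
  have hsh' : (min 1 (‖X.τ₀ x‖ ^ 2)) ^ (-k) ≤ (1 + P) ^ ((X.defEmb.card : ℝ) * k) := by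
    refine hsh.trans (Real.rpow_le_rpow (by positivity) ?_ (by positivity))
    have := X.sum_def_le_sum x
    linarith
  have ht2 : ‖X.τ₀ x‖ ^ 2 ≤ 1 + P := by
    have := X.tau_sq_le_sum x
    linarith
  rw [Real.rpow_add_one (by linarith : (1 + P) ≠ 0)]
  calc ‖X.τ₀ x‖ ^ 2 * (min 1 (‖X.τ₀ x‖ ^ 2)) ^ (-k) ≤ (1 + P) * (1 + P) ^ ((X.defEmb.card : ℝ) * k) := by
        gcongr
    _ = (1 + P) ^ ((X.defEmb.card : ℝ) * k) * (1 + P) := by ring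

/-! ## 3. The weighted base count is summable -/

/-- **THE WEIGHTED BASE TERM IS GAUSSIAN IN THE HOUSES** (one tuple): with `c := π a₀ − e > 0`, `λ := c/2`,
`b := |defEmb| k + 1`, `K := (⌈b⌉₊!/λ^{⌈b⌉₊}) e^{λ}`, for an integral tuple of non-zero scalars satisfying the quadratic
lower bound at `xm`. -/
theorem weighted_term_le (xm : X.Tuple) {A k : ℝ} (hA : 0 ≤ A) (hk : 0 ≤ k) {Λ₀ e a₀ b₀ : ℝ} (hΛ0 : 0 ≤ Λ₀)
    (he : 0 ≤ e) (ha₀ : 0 < a₀) (hcap : e < Real.pi * a₀) (ε : Fin 4 → X.E) (hint : ∀ j, IsIntegral ℤ (ε j))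
    (hne : ∀ j, ε j ≠ 0) (hq : a₀ * (∑ j, ∑ σ : X.E →+* ℂ, ‖σ (ε j)‖ ^ 2) - b₀ ≤ X.profileExc ε xm) :
    X.shrinkW A k ε * (Λ₀ * X.scalarWeight e ε) * Real.exp (-(Real.pi * X.profileExc ε xm)) ≤
      (A * Λ₀ * Real.exp (Real.pi * b₀) *
        (((⌈((X.defEmb.card : ℝ) * k + 1)⌉₊.factorial : ℝ) / ((Real.pi * a₀ - e) / 2) ^ ⌈((X.defEmb.card : ℝ) * k + 1)⌉₊) *
          Real.exp ((Real.pi * a₀ - e) / 2)) ^ 4) *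
        Real.exp (-(((Real.pi * a₀ - e) / 2) * ∑ j, ‖mixedEmbedding X.E (ε j)‖ ^ 2)) := by
  have hc0 : 0 < Real.pi * a₀ - e := by linarith
  have hlam0 : 0 < (Real.pi * a₀ - e) / 2 := by positivity
  have hK0 : 0 ≤ ((⌈((X.defEmb.card : ℝ) * k + 1)⌉₊.factorial : ℝ) /
      ((Real.pi * a₀ - e) / 2) ^ ⌈((X.defEmb.card : ℝ) * k + 1)⌉₊) * Real.exp ((Real.pi * a₀ - e) / 2) := by
    positivity
  -- the per-slot sizes
  have hP0 : ∀ j, 0 ≤ ∑ σ : X.E →+* ℂ, ‖σ (ε j)‖ ^ 2 := fun j => Finset.sum_nonneg fun σ _ => sq_nonneg _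
  -- (1) the weight, (2) the profile exponent
  have hw := X.scalarWeight_le_exp he ε
  have hp : Real.exp (-(Real.pi * X.profileExc ε xm)) ≤
      Real.exp (Real.pi * b₀) * Real.exp (-(Real.pi * a₀ * ∑ j, ∑ σ : X.E →+* ℂ, ‖σ (ε j)‖ ^ 2)) := by
    rw [← Real.exp_add]
    apply Real.exp_le_exp.2
    nlinarith [Real.pi_pos]
  -- (3) the per-slot factors
  have hslot : ∀ j, ‖X.τ₀ (ε j)‖ ^ 2 * (min 1 (‖X.τ₀ (ε j)‖ ^ 2)) ^ (-k) *
      Real.exp (-((Real.pi * a₀ - e) * ∑ σ : X.E →+* ℂ, ‖σ (ε j)‖ ^ 2)) ≤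
      (((⌈((X.defEmb.card : ℝ) * k + 1)⌉₊.factorial : ℝ) /
        ((Real.pi * a₀ - e) / 2) ^ ⌈((X.defEmb.card : ℝ) * k + 1)⌉₊) * Real.exp ((Real.pi * a₀ - e) / 2)) *
        Real.exp (-(((Real.pi * a₀ - e) / 2) * ∑ σ : X.E →+* ℂ, ‖σ (ε j)‖ ^ 2)) := by
    intro j
    have h1 := X.slot_poly_le (hint j) (hne j) hk
    have h2 := rpow_mul_exp_neg_le (P := ∑ σ : X.E →+* ℂ, ‖σ (ε j)‖ ^ 2) (b := (X.defEmb.card : ℝ) * k + 1)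
      (lam := (Real.pi * a₀ - e) / 2) (hP0 j) hlam0
    have hsplit : Real.exp (-((Real.pi * a₀ - e) * ∑ σ : X.E →+* ℂ, ‖σ (ε j)‖ ^ 2)) =
        Real.exp (-(((Real.pi * a₀ - e) / 2) * ∑ σ : X.E →+* ℂ, ‖σ (ε j)‖ ^ 2)) *
          Real.exp (-(((Real.pi * a₀ - e) / 2) * ∑ σ : X.E →+* ℂ, ‖σ (ε j)‖ ^ 2)) := by
      rw [← Real.exp_add]; congr 1; ring
    have h3 : 0 ≤ ‖X.τ₀ (ε j)‖ ^ 2 * (min 1 (‖X.τ₀ (ε j)‖ ^ 2)) ^ (-k) := by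
      have : 0 ≤ (min 1 (‖X.τ₀ (ε j)‖ ^ 2)) ^ (-k) := Real.rpow_nonneg (by positivity) _
      positivity
    have hE0 : 0 ≤ Real.exp (-(((Real.pi * a₀ - e) / 2) * ∑ σ : X.E →+* ℂ, ‖σ (ε j)‖ ^ 2)) :=
      (Real.exp_pos _).le
    calc ‖X.τ₀ (ε j)‖ ^ 2 * (min 1 (‖X.τ₀ (ε j)‖ ^ 2)) ^ (-k) *
          Real.exp (-((Real.pi * a₀ - e) * ∑ σ : X.E →+* ℂ, ‖σ (ε j)‖ ^ 2))
        = (‖X.τ₀ (ε j)‖ ^ 2 * (min 1 (‖X.τ₀ (ε j)‖ ^ 2)) ^ (-k) *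
            Real.exp (-(((Real.pi * a₀ - e) / 2) * ∑ σ : X.E →+* ℂ, ‖σ (ε j)‖ ^ 2))) *
            Real.exp (-(((Real.pi * a₀ - e) / 2) * ∑ σ : X.E →+* ℂ, ‖σ (ε j)‖ ^ 2)) := by rw [hsplit]; ring
      _ ≤ ((1 + ∑ σ : X.E →+* ℂ, ‖σ (ε j)‖ ^ 2) ^ ((X.defEmb.card : ℝ) * k + 1) *
            Real.exp (-(((Real.pi * a₀ - e) / 2) * ∑ σ : X.E →+* ℂ, ‖σ (ε j)‖ ^ 2))) *
            Real.exp (-(((Real.pi * a₀ - e) / 2) * ∑ σ : X.E →+* ℂ, ‖σ (ε j)‖ ^ 2)) :=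
          mul_le_mul_of_nonneg_right (mul_le_mul_of_nonneg_right h1 hE0) hE0
      _ ≤ _ := mul_le_mul_of_nonneg_right h2 hE0
  -- (4) assemble
  have hshrink : X.shrinkW A k ε = A * ∏ j, (‖X.τ₀ (ε j)‖ ^ 2 * (min 1 (‖X.τ₀ (ε j)‖ ^ 2)) ^ (-k)) := by
    unfold shrinkW
    rw [Finset.prod_mul_distrib]
    ring
  have hexpc : Real.exp (e * ∑ j, ∑ σ : X.E →+* ℂ, ‖σ (ε j)‖ ^ 2) *
      Real.exp (-(Real.pi * a₀ * ∑ j, ∑ σ : X.E →+* ℂ, ‖σ (ε j)‖ ^ 2)) =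
      ∏ j, Real.exp (-((Real.pi * a₀ - e) * ∑ σ : X.E →+* ℂ, ‖σ (ε j)‖ ^ 2)) := by
    rw [← Real.exp_add, ← Real.exp_sum]
    congr 1
    rw [Finset.mul_sum, Finset.mul_sum, ← Finset.sum_neg_distrib, ← Finset.sum_add_distrib]
    refine Finset.sum_congr rfl fun j _ => ?_
    ring
  have hprod := Finset.prod_le_prod (s := (Finset.univ : Finset (Fin 4))) (fun j _ => ?_) (fun j _ => hslot j)
  swap
  · have : 0 ≤ (min 1 (‖X.τ₀ (ε j)‖ ^ 2)) ^ (-k) := Real.rpow_nonneg (by positivity) _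
    positivity
  have hmixed : Real.exp (-(((Real.pi * a₀ - e) / 2) * ∑ j, ∑ σ : X.E →+* ℂ, ‖σ (ε j)‖ ^ 2)) ≤
      Real.exp (-(((Real.pi * a₀ - e) / 2) * ∑ j, ‖mixedEmbedding X.E (ε j)‖ ^ 2)) := by
    apply Real.exp_le_exp.2
    have : ∑ j, ‖mixedEmbedding X.E (ε j)‖ ^ 2 ≤ ∑ j, ∑ σ : X.E →+* ℂ, ‖σ (ε j)‖ ^ 2 :=
      Finset.sum_le_sum fun j _ => X.mixed_norm_sq_le_sum (ε j)
    nlinarith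
  have hKprod : ∏ j : Fin 4, ((((⌈((X.defEmb.card : ℝ) * k + 1)⌉₊.factorial : ℝ) /
      ((Real.pi * a₀ - e) / 2) ^ ⌈((X.defEmb.card : ℝ) * k + 1)⌉₊) * Real.exp ((Real.pi * a₀ - e) / 2)) *
      Real.exp (-(((Real.pi * a₀ - e) / 2) * ∑ σ : X.E →+* ℂ, ‖σ (ε j)‖ ^ 2))) =
      (((⌈((X.defEmb.card : ℝ) * k + 1)⌉₊.factorial : ℝ) /
        ((Real.pi * a₀ - e) / 2) ^ ⌈((X.defEmb.card : ℝ) * k + 1)⌉₊) * Real.exp ((Real.pi * a₀ - e) / 2)) ^ 4 *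
      Real.exp (-(((Real.pi * a₀ - e) / 2) * ∑ j, ∑ σ : X.E →+* ℂ, ‖σ (ε j)‖ ^ 2)) := by
    rw [Finset.prod_mul_distrib, Finset.prod_const, Finset.card_univ, Fintype.card_fin, Finset.mul_sum,
      ← Finset.sum_neg_distrib, Real.exp_sum]
  have hR : ∏ j, (‖X.τ₀ (ε j)‖ ^ 2 * (min 1 (‖X.τ₀ (ε j)‖ ^ 2)) ^ (-k) *
      Real.exp (-((Real.pi * a₀ - e) * ∑ σ : X.E →+* ℂ, ‖σ (ε j)‖ ^ 2))) =
      (∏ j, (‖X.τ₀ (ε j)‖ ^ 2 * (min 1 (‖X.τ₀ (ε j)‖ ^ 2)) ^ (-k))) *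
        ∏ j, Real.exp (-((Real.pi * a₀ - e) * ∑ σ : X.E →+* ℂ, ‖σ (ε j)‖ ^ 2)) := Finset.prod_mul_distrib
  calc X.shrinkW A k ε * (Λ₀ * X.scalarWeight e ε) * Real.exp (-(Real.pi * X.profileExc ε xm))
      ≤ X.shrinkW A k ε * (Λ₀ * Real.exp (e * ∑ j, ∑ σ : X.E →+* ℂ, ‖σ (ε j)‖ ^ 2)) *
          (Real.exp (Real.pi * b₀) * Real.exp (-(Real.pi * a₀ * ∑ j, ∑ σ : X.E →+* ℂ, ‖σ (ε j)‖ ^ 2))) :=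
        mul_le_mul (mul_le_mul_of_nonneg_left (mul_le_mul_of_nonneg_left hw hΛ0) (X.shrinkW_nonneg hA k _)) hp
          (Real.exp_pos _).le (mul_nonneg (X.shrinkW_nonneg hA k _) (mul_nonneg hΛ0 (Real.exp_pos _).le))
    _ = A * Λ₀ * Real.exp (Real.pi * b₀) *
          ∏ j, (‖X.τ₀ (ε j)‖ ^ 2 * (min 1 (‖X.τ₀ (ε j)‖ ^ 2)) ^ (-k) *
            Real.exp (-((Real.pi * a₀ - e) * ∑ σ : X.E →+* ℂ, ‖σ (ε j)‖ ^ 2))) := by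
        rw [hR, ← hexpc, hshrink]
        ring
    _ ≤ A * Λ₀ * Real.exp (Real.pi * b₀) *
          ∏ j, ((((⌈((X.defEmb.card : ℝ) * k + 1)⌉₊.factorial : ℝ) /
            ((Real.pi * a₀ - e) / 2) ^ ⌈((X.defEmb.card : ℝ) * k + 1)⌉₊) * Real.exp ((Real.pi * a₀ - e) / 2)) *
            Real.exp (-(((Real.pi * a₀ - e) / 2) * ∑ σ : X.E →+* ℂ, ‖σ (ε j)‖ ^ 2))) := by
        gcongr
    _ = A * Λ₀ * Real.exp (Real.pi * b₀) *
          (((⌈((X.defEmb.card : ℝ) * k + 1)⌉₊.factorial : ℝ) /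
            ((Real.pi * a₀ - e) / 2) ^ ⌈((X.defEmb.card : ℝ) * k + 1)⌉₊) * Real.exp ((Real.pi * a₀ - e) / 2)) ^ 4 *
          Real.exp (-(((Real.pi * a₀ - e) / 2) * ∑ j, ∑ σ : X.E →+* ℂ, ‖σ (ε j)‖ ^ 2)) := by
        rw [hKprod]; ring
    _ ≤ _ := by gcongr

/-- **THE WEIGHTED BASE COUNT IS SUMMABLE** under the quadratic lower bound of the profile exponent and `e < π a₀`. -/
theorem summable_base_count_weighted {S : Set (Fin 4 → X.E)} (hS : X.IntegralScalars S) (xm : X.Tuple) {A k : ℝ}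
    (hA : 0 ≤ A) (hk : 0 ≤ k) {Λ₀ e a₀ b₀ : ℝ} (hΛ0 : 0 ≤ Λ₀) (he : 0 ≤ e) (ha₀ : 0 < a₀) (hcap : e < Real.pi * a₀)
    (hquad : ∀ ε ∈ X.NonNormOne S, a₀ * (∑ j, ∑ σ : X.E →+* ℂ, ‖σ (ε j)‖ ^ 2) - b₀ ≤ X.profileExc ε xm) :
    Summable fun ε : X.NonNormOne S =>
      X.shrinkW A k ε.1 * (Λ₀ * X.scalarWeight e ε.1) * Real.exp (-(Real.pi * X.profileExc ε.1 xm)) := by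
  have hlam0 : 0 < (Real.pi * a₀ - e) / 2 := by linarith
  -- the injection into the integral tuples
  let ι : X.NonNormOne S → (Fin 4 → 𝓞 X.E) := fun ε j => ⟨ε.1 j, hS _ ε.2.1 j⟩
  have hι : Function.Injective ι := by
    intro ε ε' h
    apply Subtype.ext
    funext j
    have := congrArg (fun f : Fin 4 → 𝓞 X.E => ((f j : 𝓞 X.E) : X.E)) h
    simpa [ι] using this
  have hG : Summable fun ε : Fin 4 → 𝓞 X.E =>
      (A * Λ₀ * Real.exp (Real.pi * b₀) *
        (((⌈((X.defEmb.card : ℝ) * k + 1)⌉₊.factorial : ℝ) / ((Real.pi * a₀ - e) / 2) ^ ⌈((X.defEmb.card : ℝ) * k + 1)⌉₊) *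
          Real.exp ((Real.pi * a₀ - e) / 2)) ^ 4) *
        Real.exp (-(((Real.pi * a₀ - e) / 2) * ∑ j, ‖mixedEmbedding X.E (ε j : X.E)‖ ^ 2)) :=
    (summable_gauss_mixedNorm_sq_tuple hlam0).mul_left _
  refine Summable.of_nonneg_of_le (fun ε => ?_) (fun ε => ?_) (hG.comp_injective hι)
  · exact mul_nonneg (mul_nonneg (X.shrinkW_nonneg hA k _) (mul_nonneg hΛ0 (X.scalarWeight_nonneg e _)))
      (Real.exp_pos _).le
  · simp only [Function.comp_apply, ι]
    exact X.weighted_term_le xm hA hk hΛ0 he ha₀ hcap ε.1 (fun j => hS _ ε.2.1 j) ε.2.2.1 (hquad ε.1 ε.2)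

/-! ## 4. The weighted count along the ray -/

/-- **THE WEIGHTED COUNT AT `n • xm` IS BOUNDED BY THE WEIGHTED GAUSSIAN COUNT** (`n ≥ 1`, signed profile exponents
`≥ 0`), and is summable. -/
theorem copyCount_rayCentre_le_red_weighted {D : X.ThetaData} {S : Set (Fin 4 → X.E)} (hS : X.IntegralScalars S)
    {xm : X.Tuple} {n : ℕ} (hn : 1 ≤ n) (c : X.CopyData D S (X.rayCentre xm n)) {A k : ℝ}
    (hA : 0 ≤ A) (hk : 0 ≤ k) {Λ₀ e a₀ b₀ : ℝ} (hΛ0 : 0 ≤ Λ₀) (he : 0 ≤ e) (ha₀ : 0 < a₀) (hcap : e < Real.pi * a₀)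
    (hquad : ∀ ε ∈ X.NonNormOne S, a₀ * (∑ j, ∑ σ : X.E →+* ℂ, ‖σ (ε j)‖ ^ 2) - b₀ ≤ X.profileExc ε xm)
    (hΛ : ∀ o ∈ X.Copies S (X.rayCentre xm n),
      ‖c.lam o 0 * c.lam o 1 * conj (c.lam o 2 * c.lam o 3)‖ ≤ Λ₀ * X.scalarWeight e (c.rep o))
    (hprof : ∀ ε ∈ X.NonNormOne S, 0 ≤ X.profileExc ε xm) :
    (Summable fun o => if o ∈ X.Copies S (X.rayCentre xm n) ∧ o ≠ X.orbitOf (X.lines (X.rayCentre xm n)) then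
      X.shrinkMajRed A k (c.rep o) (X.rayCentre xm n) * ‖c.lam o 0 * c.lam o 1 * conj (c.lam o 2 * c.lam o 3)‖
      else 0) ∧
    (∑' o, if o ∈ X.Copies S (X.rayCentre xm n) ∧ o ≠ X.orbitOf (X.lines (X.rayCentre xm n)) then
      X.shrinkMajRed A k (c.rep o) (X.rayCentre xm n) * ‖c.lam o 0 * c.lam o 1 * conj (c.lam o 2 * c.lam o 3)‖
      else 0) ≤
    gaussCount (fun ε : X.NonNormOne S => X.shrinkW A k ε.1 * (Λ₀ * X.scalarWeight e ε.1))
      (fun ε => X.profileExc ε.1 xm) n := by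
  have hbase := X.summable_base_count_weighted hS xm hA hk hΛ0 he ha₀ hcap hquad (S := S)
  have hw0 : ∀ ε : X.NonNormOne S, 0 ≤ X.shrinkW A k ε.1 * (Λ₀ * X.scalarWeight e ε.1) := fun ε =>
    mul_nonneg (X.shrinkW_nonneg hA k _) (mul_nonneg hΛ0 (X.scalarWeight_nonneg e _))
  have hE0 : ∀ ε : X.NonNormOne S, 0 ≤ X.profileExc ε.1 xm := fun ε => hprof ε.1 ε.2
  have hg : Summable fun ε : X.NonNormOne S =>
      X.shrinkW A k ε.1 * (Λ₀ * X.scalarWeight e ε.1) *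
        Real.exp (-(Real.pi * (n : ℝ) ^ 2 * X.profileExc ε.1 xm)) :=
    summable_gauss_ray hw0 hE0 hbase hn
  set W : X.Orbit → ℝ := fun o => X.shrinkMajRed A k (c.rep o) (X.rayCentre xm n) *
    ‖c.lam o 0 * c.lam o 1 * conj (c.lam o 2 * c.lam o 3)‖ with hW
  have hle : ∀ o : X.NonMainCopies S (X.rayCentre xm n), W o.1 ≤
      X.shrinkW A k (c.nnRep o).1 * (Λ₀ * X.scalarWeight e (c.nnRep o).1) *
        Real.exp (-(Real.pi * (n : ℝ) ^ 2 * X.profileExc (c.nnRep o).1 xm)) := by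
    intro o
    simp only [hW, CopyData.nnRep]
    rw [X.shrinkMajRed_rayCentre]
    have h1 := hΛ o.1 o.2.1
    have h2 : 0 ≤ X.shrinkW A k (c.rep o.1) * Real.exp (-(Real.pi * (n : ℝ) ^ 2 * X.profileExc (c.rep o.1) xm)) :=
      mul_nonneg (X.shrinkW_nonneg hA k _) (Real.exp_pos _).le
    calc X.shrinkW A k (c.rep o.1) * Real.exp (-(Real.pi * (n : ℝ) ^ 2 * X.profileExc (c.rep o.1) xm)) *
          ‖c.lam o.1 0 * c.lam o.1 1 * conj (c.lam o.1 2 * c.lam o.1 3)‖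
        ≤ X.shrinkW A k (c.rep o.1) * Real.exp (-(Real.pi * (n : ℝ) ^ 2 * X.profileExc (c.rep o.1) xm)) *
          (Λ₀ * X.scalarWeight e (c.rep o.1)) := mul_le_mul_of_nonneg_left h1 h2
      _ = X.shrinkW A k (c.rep o.1) * (Λ₀ * X.scalarWeight e (c.rep o.1)) *
          Real.exp (-(Real.pi * (n : ℝ) ^ 2 * X.profileExc (c.rep o.1) xm)) := by ring
  have hW0 : ∀ o, 0 ≤ W o := fun o => by
    have h1 : 0 ≤ X.shrinkMajRed A k (c.rep o) (X.rayCentre xm n) := by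
      rw [X.shrinkMajRed_rayCentre]
      exact mul_nonneg (X.shrinkW_nonneg hA k _) (Real.exp_pos _).le
    exact mul_nonneg h1 (norm_nonneg _)
  have hf : Summable fun o : X.NonMainCopies S (X.rayCentre xm n) => W o.1 :=
    Summable.of_nonneg_of_le (fun o => hW0 o.1) hle (hg.comp_injective c.nnRep_injective)
  have hfun : (fun o => if o ∈ X.Copies S (X.rayCentre xm n) ∧ o ≠ X.orbitOf (X.lines (X.rayCentre xm n)) then
      X.shrinkMajRed A k (c.rep o) (X.rayCentre xm n) * ‖c.lam o 0 * c.lam o 1 * conj (c.lam o 2 * c.lam o 3)‖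
      else 0) = (X.NonMainCopies S (X.rayCentre xm n)).indicator W := by
    funext o
    simp only [Set.indicator_apply, NonMainCopies, Set.mem_setOf_eq, hW]
  refine ⟨?_, ?_⟩
  · rw [hfun]
    exact (summable_subtype_iff_indicator (s := X.NonMainCopies S (X.rayCentre xm n)) (f := W)).1 hf
  · rw [hfun, tsum_subtype (X.NonMainCopies S (X.rayCentre xm n)) W |>.symm]
    unfold gaussCount
    exact hf.tsum_le_tsum_of_inj c.nnRep c.nnRep_injective
      (fun ε _ => mul_nonneg (hw0 ε) (Real.exp_pos _).le) hle hg

/-- **THE WEIGHTED COUNT ALONG THE RAY, UNDER THE STRICT SIGNED PROFILE CONDITION** (C-L3-WEIGHT, bus S14888): with the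
phase bound `‖Λ(o)‖ ≤ Λ₀ · scalarWeight e (rep o)` in place of the uniform `Λ₀`, under the quadratic lower bound
`a₀ Σ_j Σ_σ ‖σ (ε j)‖² − b₀ ≤ profileExc ε xm` on the non-norm-one tuples and `e < π a₀`: for every `θ > 0`, from some
scale on, the count over the copies of `n • xm` is summable and `≤ θ` — the conclusion of
`eventually_copyCount_rayCentre_red` verbatim (`e := 0`, `b₀ := 0`, `a₀` arbitrary recovers it); the hypothesis
`hx : ∀ j, xm j ≠ 0` of the unweighted theorem is not needed (the quadratic bound replaces the definite-size floor). -/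
theorem eventually_copyCount_rayCentre_red_weighted {D : X.ThetaData} {S : Set (Fin 4 → X.E)}
    (hS : X.IntegralScalars S) {xm : X.Tuple} (c : ∀ n : ℕ, X.CopyData D S (X.rayCentre xm n))
    {A k : ℝ} (hA : 0 ≤ A) (hk : 0 ≤ k) {Λ₀ e a₀ b₀ : ℝ} (hΛ0 : 0 ≤ Λ₀) (he : 0 ≤ e) (ha₀ : 0 < a₀)
    (hcap : e < Real.pi * a₀)
    (hquad : ∀ ε ∈ X.NonNormOne S, a₀ * (∑ j, ∑ σ : X.E →+* ℂ, ‖σ (ε j)‖ ^ 2) - b₀ ≤ X.profileExc ε xm)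
    (hΛ : ∀ n, ∀ o ∈ X.Copies S (X.rayCentre xm n),
      ‖(c n).lam o 0 * (c n).lam o 1 * conj ((c n).lam o 2 * (c n).lam o 3)‖ ≤ Λ₀ * X.scalarWeight e ((c n).rep o))
    (hprof : ∀ ε ∈ X.NonNormOne S, 0 < X.profileExc ε xm) {θ : ℝ} (hθ : 0 < θ) :
    ∀ᶠ n : ℕ in atTop,
      (Summable fun o => if o ∈ X.Copies S (X.rayCentre xm n) ∧ o ≠ X.orbitOf (X.lines (X.rayCentre xm n)) then
        X.shrinkMajRed A k ((c n).rep o) (X.rayCentre xm n) *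
          ‖(c n).lam o 0 * (c n).lam o 1 * conj ((c n).lam o 2 * (c n).lam o 3)‖ else 0) ∧
      (∑' o, if o ∈ X.Copies S (X.rayCentre xm n) ∧ o ≠ X.orbitOf (X.lines (X.rayCentre xm n)) then
        X.shrinkMajRed A k ((c n).rep o) (X.rayCentre xm n) *
          ‖(c n).lam o 0 * (c n).lam o 1 * conj ((c n).lam o 2 * (c n).lam o 3)‖ else 0) ≤ θ := by
  have hbase := X.summable_base_count_weighted hS xm hA hk hΛ0 he ha₀ hcap hquad (S := S)
  have hw0 : ∀ ε : X.NonNormOne S, 0 ≤ X.shrinkW A k ε.1 * (Λ₀ * X.scalarWeight e ε.1) := fun ε =>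
    mul_nonneg (X.shrinkW_nonneg hA k _) (mul_nonneg hΛ0 (X.scalarWeight_nonneg e _))
  have hE : ∀ ε : X.NonNormOne S, 0 < X.profileExc ε.1 xm := fun ε => hprof ε.1 ε.2
  have htail := eventually_tsum_gauss_ray_le hw0 hE hbase hθ
  filter_upwards [htail, Filter.eventually_ge_atTop 1] with n hn hn1
  obtain ⟨hsum, hle⟩ := X.copyCount_rayCentre_le_red_weighted hS hn1 (c n) hA hk hΛ0 he ha₀ hcap hquad (hΛ n)
    fun ε hε => (hprof ε hε).le
  exact ⟨hsum, hle.trans hn⟩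

end T4Data

end Summit.Ventures.HodgeRepro.Tier4.Line3

end
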